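import Literature.Probability.RandomPlanarGeometry.LoewnerGrowth
import Literature.Probability.RandomPlanarGeometry.SLE
import HarnessLib

/-!
# The Rohde–Schramm trace theorem, decomposed: Thm 5.1 = Thm 3.6 (stochastic) + Thm 4.1 (deterministic)

Trunk T-STOCH. The named fact `Literature.Probability.RandomPlanarGeometry.hasSLETrace_of_ne_eight`
(`Literature/Probability/RandomPlanarGeometry/SLE.lean`: for `κ ≠ 8`, chordal SLE_κ is a.s.
generated by a curve; Rohde–Schramm, *Basic properties of SLE*, Ann. Math. 161 (2005), Thm. 5.1)
is proved in the source in two lines (p. 899): "By Theorem 3.6, a.s. `lim_{y↓0} f̂ₜ(iy)` exists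
for all `t` and is continuous. Therefore we can apply Theorem 4.1, and the theorem follows."
We vendor the two ingredients as named facts, faithfully to their printed scope, and **prove the
assembly**:

* `Literature.Probability.RandomPlanarGeometry.RohdeSchramm2005_thm36` — **Thm. 3.6** (§3, standing assumption `κ > 0`; `κ ≠ 8`): a.s.
  the function `H(y, t) = f̂ₜ(iy) = gₜ⁻¹(ξ(t) + iy)`, `y > 0`, extends continuously to
  `[0, ∞) × [0, ∞)`. A stochastic-calculus estimate (Cor. 3.5, moments of `|f̂ₜ'(iy)|`,
  Borel–Cantelli on dyadic boxes); XL.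
* `Literature.Probability.RandomPlanarGeometry.RohdeSchramm2005_thm41` — **Thm. 4.1** (§4, deterministic; `ξ` any continuous function):
  if `β(t) := lim_{y↓0} gₜ⁻¹(ξ(t) + iy)` exists for all `t` and is continuous, then `Hₜ` is the
  unbounded component of `ℍ ∖ β[0, t]` for every `t` (the clause "`gₜ⁻¹` extends continuously
  to `ℍ̄`" of the printed conclusion is omitted). Deterministic complex analysis; L (its converse
  is `Loewner.IsGeneratedByCurve.tendsto_invFunOn_map`, `LoewnerTraceLimit.lean`).
* `Literature.hasSLETrace_zero_of_thm41` — the case `κ = 0` not covered by §3 (driving function `0`):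
  the backward flow is explicit, `fₜ(iy) = i√(y² + 4t) → 2i√t`, so Thm. 4.1 applies with
  `β(t) = 2i√t` (**proved** here from the flow API of `LoewnerFlow`/`LoewnerGrowth`).
* `Literature.Probability.RandomPlanarGeometry.hasSLETrace_of_ne_eight_of_RS05` — **Thm. 5.1 from Thm. 3.6 and Thm. 4.1** (proved
  assembly, as printed, plus the `κ = 0` case).

## References

* S. Rohde, O. Schramm, *Basic properties of SLE*, Ann. of Math. 161 (2005) 883–924: §2 (p. 887,
  `fₜ := gₜ⁻¹`, `f̂ₜ(z) := fₜ(z + ξ(t))`), Thm. 3.6 (p. 895), Thm. 4.1 (p. 898), Thm. 5.1 and its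
  proof (p. 899).
-/

noncomputable section

open Set Filter Topology Metric Complex MeasureTheory
open UpperHalfPlane (upperHalfPlaneSet isOpen_upperHalfPlaneSet)
open scoped NNReal

namespace Literature.Probability.RandomPlanarGeometry

/-! ### The two named facts -/

/-- **Rohde–Schramm (2005), Theorem 3.6.** Let `κ > 0` (standing assumption of §3), `κ ≠ 8`,
`ξ = √κ B` the SLE_κ driving function, `gₜ` its Loewner chain, `fₜ = gₜ⁻¹` and
`f̂ₜ(z) = fₜ(z + ξ(t))` (p. 887). Define `H(y, t) := f̂ₜ(iy)` for `y > 0`, `t ≥ 0`. Then almost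
surely `H` extends continuously to `[0, ∞) × [0, ∞)`. Here `fₜ` is the inverse
`Function.invFunOn (Loewner.map ξ t) (Loewner.domain ξ t)` of the Loewner map on
`Hₜ` (a bijection `Hₜ → ℍₒ`, `Loewner.bijOn_map`). (The Update p. 911 extends this to `κ = 8` via
[LSW]; not included.) [cite: RohdeSchramm2005, Thm 3.6] -/
def RohdeSchramm2005_thm36 : Prop :=
  ∀ {κ : ℝ≥0}, κ ≠ 0 → κ ≠ 8 → ∀ᵐ ω ∂Process.preWienerMeasure,
    ∃ H : ℝ≥0 × ℝ≥0 → ℂ, Continuous H ∧ ∀ (y t : ℝ≥0), y ≠ 0 →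
      H (y, t) = Function.invFunOn (Loewner.map (sleDriving κ ω) t)
        (Loewner.domain (sleDriving κ ω) t) ((sleDriving κ ω t : ℂ) + I * (y : ℝ))

/-- **Rohde–Schramm (2005), Theorem 4.1** (deterministic criterion for hulls to be generated by a
path). Let `ξ : [0, ∞) → ℝ` be continuous and `gₜ` the corresponding solution of the Loewner
equation (2.1). Assume that `β(t) := lim_{y↓0} gₜ⁻¹(ξ(t) + iy)` exists for all `t ∈ [0, ∞)`
and is continuous. Then (`gₜ⁻¹` extends continuously to `ℍ̄` and) `Hₜ` is the unbounded
connected component of `ℍ ∖ β([0, t])`, for every `t`. Stated with `gₜ⁻¹ = invFunOn gₜ Hₜ` and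
the conclusion in the form `Kₜ = ℍₒ ∖ unboundedComponent (ℍₒ ∖ β[0,t])` (equivalent to
`Hₜ = unboundedComponent …` as the latter lies in `ℍₒ`); the continuous-extension clause is
omitted. [cite: RohdeSchramm2005, Thm 4.1] -/
def RohdeSchramm2005_thm41 : Prop :=
  ∀ {ξ : ℝ≥0 → ℝ} {β : ℝ≥0 → ℂ}, Continuous ξ → Continuous β →
    (∀ t : ℝ≥0, Tendsto (fun y : ℝ ↦ Function.invFunOn (Loewner.map ξ t) (Loewner.domain ξ t)
      ((ξ t : ℂ) + I * y)) (𝓝[>] 0) (𝓝 (β t))) →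
    ∀ t : ℝ≥0, Loewner.hull ξ t =
      upperHalfPlaneSet \ Loewner.unboundedComponent (upperHalfPlaneSet \ β '' Icc 0 t)

/-! ### From the boundary limits to a generating curve -/

namespace Loewner

/-- Boundary limits of `fₜ` within `(0, ∞) i` above `ξ(t)` lie in the closed upper half-plane.
[folklore] -/
theorem im_nonneg_of_tendsto_invFunOn_map {ξ : ℝ≥0 → ℝ} (hξ : Continuous ξ) {t : ℝ≥0} {b : ℂ}
    (h : Tendsto (fun y : ℝ ↦ Function.invFunOn (map ξ t) (domain ξ t) ((ξ t : ℂ) + I * y))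
      (𝓝[>] 0) (𝓝 b)) : 0 ≤ b.im := by
  have hmem : ∀ᶠ y : ℝ in 𝓝[>] 0, 0 ≤ (Function.invFunOn (map ξ t) (domain ξ t)
      ((ξ t : ℂ) + I * y)).im := by
    filter_upwards [self_mem_nhdsWithin] with y hy
    have hw : ((ξ t : ℂ) + I * y) ∈ upperHalfPlaneSet := by
      change 0 < ((ξ t : ℂ) + I * y).im
      simpa using hy
    exact le_of_lt (domain_subset ξ t ((bijOn_invFunOn_map hξ t).mapsTo hw))
  exact ge_of_tendsto (Complex.continuous_im.continuousAt.tendsto.comp h) hmem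

/-- At time `0`, `f₀ = id` on `ℍₒ`, so the boundary limit above `ξ(0)` is `ξ(0)`. [folklore] -/
theorem eq_of_tendsto_invFunOn_map_zero {ξ : ℝ≥0 → ℝ} (hξ : Continuous ξ) {b : ℂ}
    (h : Tendsto (fun y : ℝ ↦ Function.invFunOn (map ξ 0) (domain ξ 0) ((ξ 0 : ℂ) + I * y))
      (𝓝[>] 0) (𝓝 b)) : b = ξ 0 := by
  have h2 : Tendsto (fun y : ℝ ↦ Function.invFunOn (map ξ 0) (domain ξ 0) ((ξ 0 : ℂ) + I * y))
      (𝓝[>] 0) (𝓝 ((ξ 0 : ℂ) + I * (0 : ℝ))) := by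
    have hc : Tendsto (fun y : ℝ ↦ (ξ 0 : ℂ) + I * y) (𝓝[>] 0) (𝓝 ((ξ 0 : ℂ) + I * (0 : ℝ))) :=
      ((continuous_const.add (continuous_const.mul Complex.continuous_ofReal)).tendsto 0).mono_left
        nhdsWithin_le_nhds
    refine hc.congr' ?_
    filter_upwards [self_mem_nhdsWithin] with y hy
    have hw : ((ξ 0 : ℂ) + I * y) ∈ upperHalfPlaneSet := by
      change 0 < ((ξ 0 : ℂ) + I * y).im
      simpa using hy
    -- `f₀ w = w`: `g₀ (f₀ w) = w` and `g₀ = id` on `H₀ = ℍₒ`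
    set z := Function.invFunOn (map ξ 0) (domain ξ 0) ((ξ 0 : ℂ) + I * y) with hz
    have hzH : z ∈ domain ξ 0 := (bijOn_invFunOn_map hξ 0).mapsTo hw
    have hmap : map ξ 0 z = (ξ 0 : ℂ) + I * y := (bijOn_map hξ 0).invOn_invFunOn.2 hw
    rw [map_zero_apply hξ (ne_driving_of_lt_swallowingTime ((mem_domain_iff ξ 0 z).1 hzH).2)] at hmap
    exact hmap.symm
  have := tendsto_nhds_unique h h2
  simpa using this

/-- **Theorem 4.1 yields a generating curve** in the sense of `IsGeneratedByCurve` (the extra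
clauses `β 0 = ξ 0` and `im β ≥ 0` follow from the hypothesis). [cite: RohdeSchramm2005, Thm 4.1] -/
theorem isGeneratedByCurve_of_thm41 (h41 : RohdeSchramm2005_thm41) {ξ : ℝ≥0 → ℝ} {β : ℝ≥0 → ℂ}
    (hξ : Continuous ξ) (hβ : Continuous β)
    (hlim : ∀ t : ℝ≥0, Tendsto (fun y : ℝ ↦ Function.invFunOn (map ξ t) (domain ξ t)
      ((ξ t : ℂ) + I * y)) (𝓝[>] 0) (𝓝 (β t))) :
    IsGeneratedByCurve ξ β :=
  ⟨hβ, eq_of_tendsto_invFunOn_map_zero hξ (hlim 0),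
    fun t ↦ im_nonneg_of_tendsto_invFunOn_map hξ (hlim t), h41 hξ hβ hlim⟩

/-! ### The case `κ = 0`: the explicit backward flow of the zero driving function -/

/-- For the zero driving function the backward flow above `0` is explicit:
`fₜ(iy) = i √(y² + 4t)` (`y > 0`): the path `s ↦ i√(y² + 4s)` solves the time-reversed
Loewner equation `ḣ = -2/h`. Rohde–Schramm (2005), §2 / Lawler (2005), Ex. 4.11
(`gₜ(z) = √(z² + 4t)`). [cite: Lawler2005, Ex. 4.11] -/
theorem invFunOn_map_zero_driving (t : ℝ≥0) {y : ℝ} (hy : 0 < y) :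
    Function.invFunOn (map (fun _ ↦ (0 : ℝ)) t) (domain (fun _ ↦ (0 : ℝ)) t) (I * y) =
      I * Real.sqrt (y ^ 2 + 4 * t) := by
  set W : ℝ≥0 → ℝ := fun _ ↦ 0 with hW
  have hWc : Continuous W := continuous_const
  set h : ℝ → ℂ := fun s ↦ I * Real.sqrt (y ^ 2 + 4 * s) with hh
  -- a little room below `0`
  set ε : ℝ := min 1 (y ^ 2 / 8) with hε
  have hε0 : 0 < ε := by positivity
  have hε1 : ε ≤ 1 := min_le_left _ _
  have hpos : ∀ s ∈ Icc (-ε) (t : ℝ), y ^ 2 / 2 ≤ y ^ 2 + 4 * s := by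
    intro s hs
    have : ε ≤ y ^ 2 / 8 := min_le_right _ _
    linarith [hs.1]
  have him : ∀ s ∈ Icc (-ε) (t : ℝ), 0 < (h s).im := by
    intro s hs
    simp only [hh, mul_im, I_re, I_im, one_mul, zero_add, Complex.ofReal_re,
      Complex.ofReal_im, mul_zero]
    exact Real.sqrt_pos.2 (by nlinarith [hpos s hs, pow_pos hy 2])
  have hd : ∀ s ∈ Icc (-ε) (t : ℝ),
      HasDerivWithinAt h (-vectorField W ((t : ℝ) - s) (h s)) (Icc (-1 : ℝ) t) s := by
    intro s hs
    have hps : 0 < y ^ 2 + 4 * s := by nlinarith [hpos s hs, pow_pos hy 2]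
    set c : ℝ := 4 / (2 * Real.sqrt (y ^ 2 + 4 * s)) with hc
    have h1 : HasDerivAt (fun s : ℝ ↦ Real.sqrt (y ^ 2 + 4 * s)) c s := by
      have := ((hasDerivAt_id s).const_mul 4).const_add (y ^ 2)
      simp only [mul_one] at this
      exact this.sqrt hps.ne'
    have h2 : HasDerivAt h (I * (c : ℂ)) s := h1.ofReal_comp.const_mul I
    refine h2.hasDerivWithinAt.congr_deriv ?_
    have hsq : (Real.sqrt (y ^ 2 + 4 * s) : ℂ) ≠ 0 := by
      exact_mod_cast (Real.sqrt_pos.2 hps).ne'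
    rw [vectorField_apply, hh, hc]
    simp only [hW, Complex.ofReal_zero, sub_zero]
    push_cast
    field_simp
    ring_nf
    rw [I_sq]
    ring
  have hsol := isSolution_reverse (W := W) (t := t) hε0.le hε1 hd him
  have hlt : (t : WithTop ℝ≥0) < ((((t : ℝ) + ε).toNNReal : ℝ≥0) : WithTop ℝ≥0) := by
    rw [WithTop.coe_lt_coe, ← NNReal.coe_lt_coe, Real.coe_toNNReal _ (by positivity)]
    linarith
  have hmap : map W t (h t) = I * y := by
    rw [map_eq_of_isSolution hWc hsol hlt]
    simp [hh, Real.sqrt_sq hy.le]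
  have hdom : h t ∈ domain W t := by
    rw [mem_domain_iff]
    exact ⟨him t ⟨by linarith [t.coe_nonneg], le_rfl⟩, hlt.trans_le hsol.le_swallowingTime⟩
  have hw : I * (y : ℂ) ∈ upperHalfPlaneSet := by
    change 0 < (I * (y : ℂ)).im
    simpa using hy
  exact invFunOn_map_eq hWc hw hdom hmap

/-- **SLE₀ is generated by the vertical line `t ↦ 2i√t`**, granted the deterministic criterion
Thm. 4.1: for the zero driving function `fₜ(iy) = i√(y² + 4t) → 2i√t` as `y ↓ 0`, continuously
in `t`. (The case `κ = 0` of `hasSLETrace_of_ne_eight`, outside the scope `κ > 0` of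
Rohde–Schramm's §3.) [cite: RohdeSchramm2005, Thm 4.1] -/
theorem hasSLETrace_zero_of_thm41 (h41 : RohdeSchramm2005_thm41) : HasSLETrace 0 := by
  refine ae_of_all _ fun ω ↦ ?_
  have hW : sleDriving 0 ω = fun _ ↦ (0 : ℝ) := by
    funext t; simp [sleDriving_apply]
  rw [hW]
  set β : ℝ≥0 → ℂ := fun t ↦ I * Real.sqrt (4 * t) with hβ
  refine ⟨β, isGeneratedByCurve_of_thm41 h41 continuous_const ?_ fun t ↦ ?_⟩
  · exact continuous_const.mul (Complex.continuous_ofReal.comp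
      (Real.continuous_sqrt.comp (continuous_const.mul NNReal.continuous_coe)))
  · have hc : Tendsto (fun y : ℝ ↦ I * (Real.sqrt (y ^ 2 + 4 * t) : ℂ)) (𝓝[>] 0)
        (𝓝 (I * (Real.sqrt (0 ^ 2 + 4 * t) : ℂ))) :=
      ((continuous_const.mul (Complex.continuous_ofReal.comp (Real.continuous_sqrt.comp
        ((continuous_pow 2).add continuous_const)))).tendsto 0).mono_left nhdsWithin_le_nhds
    have h0 : I * (Real.sqrt (0 ^ 2 + 4 * t) : ℂ) = β t := by simp [hβ]
    rw [h0] at hc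
    refine hc.congr' ?_
    filter_upwards [self_mem_nhdsWithin] with y hy
    rw [Complex.ofReal_zero, zero_add]
    exact (invFunOn_map_zero_driving t hy).symm

end Loewner

/-! ### Theorem 5.1 assembled -/

/-- **Rohde–Schramm (2005), Thm. 5.1 from Thm. 3.6 and Thm. 4.1** — the printed proof
(p. 899: "By Theorem 3.6, a.s. `lim_{y↓0} f̂ₜ(iy)` exists for all `t` and is continuous.
Therefore we can apply Theorem 4.1"), with the case `κ = 0` (outside §3's standing assumption
`κ > 0`) supplied by `hasSLETrace_zero_of_thm41`. [cite: RohdeSchramm2005, Thm 5.1] -/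
theorem hasSLETrace_of_ne_eight_of_RS05 (h36 : RohdeSchramm2005_thm36)
    (h41 : RohdeSchramm2005_thm41) : hasSLETrace_of_ne_eight := by
  intro κ hκ8
  by_cases hκ0 : κ = 0
  · subst hκ0
    exact Loewner.hasSLETrace_zero_of_thm41 h41
  filter_upwards [h36 hκ0 hκ8] with ω ⟨H, hHc, hH⟩
  set ξ := sleDriving κ ω with hξ
  have hξc : Continuous ξ := continuous_sleDriving κ ω
  set β : ℝ≥0 → ℂ := fun t ↦ H (0, t) with hβ
  refine ⟨β, Loewner.isGeneratedByCurve_of_thm41 h41 hξc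
    (hHc.comp (Continuous.prodMk continuous_const continuous_id)) fun t ↦ ?_⟩
  -- the limit along `y ↓ 0` is the value of the continuous extension at `(0, t)`
  have hpath : Tendsto (fun y : ℝ ↦ ((y.toNNReal, t) : ℝ≥0 × ℝ≥0)) (𝓝[>] 0) (𝓝 (0, t)) := by
    have : Tendsto (fun y : ℝ ↦ ((y.toNNReal, t) : ℝ≥0 × ℝ≥0)) (𝓝 0) (𝓝 ((0 : ℝ).toNNReal, t)) :=
      ((continuous_real_toNNReal.prodMk continuous_const).tendsto 0)
    simpa using this.mono_left nhdsWithin_le_nhds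
  refine ((hHc.continuousAt.tendsto).comp hpath).congr' ?_
  filter_upwards [self_mem_nhdsWithin] with y hy
  have hy' : (y.toNNReal : ℝ≥0) ≠ 0 := by
    simpa using hy
  rw [Function.comp_apply, hH _ _ hy', Real.coe_toNNReal _ (le_of_lt hy)]

end Literature.Probability.RandomPlanarGeometry
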